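import Summits.QuantumFields.YangMills.Theorems.BalabanUVNodesN17AtBetaOfRecordKernels
import Literature.MathematicalPhysics.QuantumFieldTheory.Balaban1983to89.Node00.Record8Inhabited

/-!
# BalabanUVNodes ∕ N17 AT A STAGE-8 RECORD `Node00.IsRecordOfRecord₈C` — DAG node N17 = spine estimate NE4 «scale-shift rate of the FULL
# β-functions» at NODE 00's Stage-8 datum `datumOfRecord₅ F N (θ.toStage5 F N)` (whose `βfun` IS `Node00.betaOfRecord₈ F N θ`, `rfl`) and at the
# record PREDICATE, BY NAME; the box cap as an `iff`; the zero-chart inhabitant (companion 5: §20–§23)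

TRACK A (YM-PLAN §2c row NE4, node N17 of 28; HUMAN RULING D-0062), seat `pub-ymgap-dag-n17-a` gen 4 (-a = KNIT-BY-NAME; ROSTER-D0062 row n17
«DEPENDENT — knit by name; nothing to hunt»).  Fifth companion of `BalabanUVNodesN17Knit` (p408968), `…KnitEdge` (p409440 ∕ p409892 ∕ p410452),
`…KnitTransfer` (p411569), `…AtBetaOfRecord` (p413688), `…AtBetaOfRecordKernels` (p414114), written for the ONE new input since: NODE 00's STAGE 8
(`Node00/Record8.lean` p414247; `Node00/Record8Inhabited.lean` p416375) — the record predicate `IsRecordOfRecord₈C F N D w`, whose witnessing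
`θ : Stage8Params F N` carry the β OF RECORD `betaOfRecord₈ F N θ = betaOfMerged βm₈ (beta0OfMerged βm₈ θ.v₀) θ.γ`,
`βm₈ := betaMerged F (mergedTermFamilyMat F N (chi7 F N θ) θ.εbg) θ.ρ8 θ.bV` (def-B's assembly line; the datum's `βfun` IS it, `Node00.βfun_stage8`, `rfl`).
So companion 4's assembly-line theorems (parameters `βm β⁰ γ`, hypothesis `hD : D.βfun = betaOfMerged …`) INSTANTIATE with `hD := βfun_stage8 F N θ`;
this file writes those instantiations, the record-PREDICATE forms (box = the binding world's window `]0, w.γ]`, clauses `0 < w.γ ≤ θ.γ` IN the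
predicate — b2b dagwriter (B′)), the box CAP as a positive characterisation, and what the cheap inhabitant of `IsRecordOfRecord₈C` does to N17.
THEOREMS ONLY: def-free, sorry-free, standard axioms.  HONEST FRAMING: count-neutral kernel bookkeeping; NE4 is NOT IN PRINT ([Balaban1987RG1] p. 264),
NOT PROVED here, DEPENDENT on rows NE2∕NE3 (N15∕N16) and the one-loop rate; `θ` is a PARAMETER, every rate a BINDER — nothing of Bałaban's β asserted,
no satisfiability claimed beyond the DEGENERATE zero-chart inhabitant (said as such); one finite T⁴ at fixed ε — nothing continuum ∕ ℝ⁴ ∕ OS ∕ mass-gap ∕ Clay.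

WHAT IS PROVED.
* §20 THE BOX CAP AS AN `iff` (parameters `βm β⁰ γ`; companion 4 §18's kernel negative made a characterisation).  For a box LARGER than the record box,
  `γ < γ'`, `0 < γ'`: `ScaleShiftRate c ρ γ' (betaOfMerged βm β⁰ γ)` IFF (a) `ScaleShiftRate c ρ γ βm` ∧ (b) the merged β at scale `k` is UNIFORMLY within
  `cρ^k` of the NEXT one-loop number on the whole record box ∧ (c) the one-loop numbers are geometrically Cauchy (`scaleShiftRate_betaOfMerged_iff_of_lt`;
  the three cases of a history `w ∈ ]0,γ']^{k+2}`: on the record box ∕ first coupling off it, tail on it ∕ tail off it).  Hence N17 on a larger box forces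
  the FULL β to be ASYMPTOTICALLY HISTORY-FREE on the record box, `|βm_k(v) − βm_k(v')| ≤ 2cρ^k` (`merged_oscillation_le_of_scaleShiftRate_of_lt`) — a
  constraint on Bałaban's β (print: `β_k(g) − β⁰_k` is the `g`-dependent remainder (2.13)), never a free witness; companion 4's face-jump negative is the
  instance `βm = 1 + g_k`.  So the crux text «`NE4OnData D₀ c ρ γ'`» takes `γ' ≤ θ.γ` (ref-B READ #87 A6 ∕ #106), now said positively.
* §21 N17 AT THE STAGE-8 DATUM `datumOfRecord₅ F N (θ.toStage5 F N)`: on every box side `γ' ≤ θ.γ` the node IS `ScaleShiftRate c ρ γ' βm₈`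
  (`N17_datumOfRecord₈_iff_merged`; node U2's triple `u2Inputs_datumOfRecord₈_iff`); the split road with both binders about the record's NAMED
  `beta0OfMerged βm₈ θ.v₀` and `βm₈ − β⁰` (`N17_datumOfRecord₈_of_rates`); what the node DELIVERS — (AF-0r) for the record's one-loop number and the
  merged remainder's rate, given the definer's `Beta0LimitExists βm₈ θ.v₀` at coherent admissible `θ.v₀` (`content_of_N17_datumOfRecord₈`); END TO END
  in kernel currency — (UD) + the history-matched step rate of the record's OWN limiting polarisation kernels
  `polLimit F (k+1) (mergedTermFamilyMat … k v ·) θ.ρ8 θ.bV` ⟹ N17 at D₀ ∧ (AF-0r) (`N17_datumOfRecord₈_of_kernelStepRate` = companion 4's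
  `N17_atAssemblyLine_of_kernelStepRate` at `βfun_stage8`); THE CAP AT STAGE 8 (`N17_datumOfRecord₈_iff_of_lt`, `merged₈_near_beta0_of_N17_of_lt`).
* §22 N17 AT THE RECORD PREDICATE `IsRecordOfRecord₈C F N D w` (`∀`-form: inputs asked of EVERY admissible `θ` whose Stage-8 datum is `D` — the
  predicate hides `θ` under `∃`; box = the world's window, cap and positivity clauses of the predicate): `N17_of_isRecordOfRecord₈C`,
  `N17_of_isRecordOfRecord₈C_rates`, `N17_of_isRecordOfRecord₈C_kernelStepRate`, `u2Inputs_of_isRecordOfRecord₈C` (node U2's triple; the N17 → N27 edge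
  itself is companion 3's `u2Output_under_of_N17_gap` verbatim at `D`).
* §23 THE ZERO-CHART INHABITANT AND N17 (chair R445 (A) species, said for the N17 row).  `Stage8Params.Admissible` has no clause on the chart
  `(Vβ, ρ8, bV)`; at `θ.ρ8 = 0` the datum's `βfun` is `zeroHBeta` (`Record8Inhabited.βfun_datumOfRecord₈_of_zeroChart`), so N17 holds there with EVERY
  `c ≥ 0`, `ρ ≥ 0`, on EVERY box (`N17_datumOfRecord₈_of_zeroChart`), and so do §21's kernel inputs with `C = C′ = 0`
  (`kernelStepRate_datumOfRecord₈_of_zeroChart`; `Record8Inhabited.polLimit_zeroChart`); packaged: `exists_isRecordOfRecord₈C_N17`.  READING: the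
  `∃`-form «some Stage-8 record satisfies N17» is INHABITED BY JUNK; the countable Stage-8 form of the N17 row is §22's `∀`-form WITH the chart displayed
  (NODE 00's Stage-9 pin `su(N) ↪ M_N(ℂ)`, located line (L9) of `Record8Inhabited`), exactly as R445 rules for N24∕N26∕N27∕N28.
Sources (locators only): [Balaban1987RG1] CMP **109** (1987) (1.20)–(1.22) p. 264, (2.12)–(2.14) p. 268, (5.10) p. 293; [Balaban1989LargeFieldII] CMP **122**
(1989) Thm 1 p. 355 (the interval constant γ); [King1986] CMP **102** (1986) Lemma 4.5 (4.38) p. 674.  Nothing here is a claim about the Yang–Mills mass gap.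
-/

open scoped Matrix.Norms.L2Operator

namespace Summit.QuantumFields.YangMills.Theorems.BalabanUVNodesN17

open Filter Topology
open Literature.MathematicalPhysics.QuantumFieldTheory.Balaban1983to89
open Literature.MathematicalPhysics.QuantumFieldTheory.Balaban1983to89.FlowStep
open Literature.MathematicalPhysics.QuantumFieldTheory.Balaban1983to89.T4CouplingMatching
open Literature.MathematicalPhysics.QuantumFieldTheory.Balaban1983to89.T4Continuum (T4Family FiniteEpsData)
open Literature.MathematicalPhysics.QuantumFieldTheory.Balaban1983to89.T4FlagMemory (tail_mem_box)
open Literature.MathematicalPhysics.QuantumFieldTheory.Balaban1983to89.B12Sec2to5 (Decay510 betaPrime510)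
open Literature.MathematicalPhysics.QuantumFieldTheory.Balaban1983to89.Beta.LimitRate (subKernel subKernel_apply)
open Literature.MathematicalPhysics.QuantumFieldTheory.Balaban1983to89.Node00
open Literature.MathematicalPhysics.QuantumFieldTheory.Balaban1983to89.T4FiniteEpsInhabited (zeroHBeta)
open Literature.MathematicalPhysics.QuantumFieldTheory.Balaban1983to89.DagBinding (WorldP)
open Summit.QuantumFields.BalabanUV.T4Continuum.Spine.NE4 (NE4OnData U2Inputs ne4OnData_iff)

/-! ## §20 THE BOX CAP AS AN `iff` — what NE4 on a box LARGER than the record box says about the merged β (parameters `βm β⁰ γ`) -/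

section CapIff
variable {βm : HBeta} {β0 : ℕ → ℝ} {γ γ' c ρ : ℝ}

/-- A record-box history extended by a first (finest) coupling `γ' > γ` lies in the larger box and OFF the record box. [folklore] -/
theorem cons_mem_box_and_notMem (hlt : γ < γ') {k : ℕ} {v : Fin (k + 1) → ℝ} (hv : v ∈ Box γ k) :
    (Fin.cons γ' v : Fin (k + 2) → ℝ) ∈ Box γ' (k + 1) ∧ (Fin.cons γ' v : Fin (k + 2) → ℝ) ∉ Box γ (k + 1) := by
  have h0 : 0 < γ' := by
    have := (mem_box.mp hv) 0
    linarith [this.1, this.2]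
  refine ⟨mem_box.mpr fun i => ?_, fun hm => ?_⟩
  · refine Fin.cases ?_ (fun j => ?_) i
    · simp only [Fin.cons_zero]; exact ⟨h0, le_rfl⟩
    · simp only [Fin.cons_succ]
      exact ⟨((mem_box.mp hv) j).1, ((mem_box.mp hv) j).2.trans hlt.le⟩
  · have h := ((mem_box.mp hm) 0).2
    simp only [Fin.cons_zero] at h
    exact (not_le.mpr hlt) h

/-- The constant history `γ' > γ` lies in `]0,γ']^{k+2}`; neither it nor its tail lies in the record box. [folklore] -/
theorem const_mem_box_and_tail_notMem (hγ' : 0 < γ') (hlt : γ < γ') (k : ℕ) :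
    (fun _ : Fin (k + 2) => γ') ∈ Box γ' (k + 1) ∧ (fun _ : Fin (k + 2) => γ') ∉ Box γ (k + 1) ∧
      Fin.tail (fun _ : Fin (k + 2) => γ') ∉ Box γ k := by
  refine ⟨mem_box.mpr fun _ => ⟨hγ', le_rfl⟩, fun hm => ?_, fun hm => ?_⟩
  · exact (not_le.mpr hlt) ((mem_box.mp hm) 0).2
  · exact (not_le.mpr hlt) ((mem_box.mp hm) 0).2

/-- **THE BOX CAP AS AN `iff`.**  For a box larger than the record box (`γ < γ'`, `0 < γ'`) the β of record `betaOfMerged βm β⁰ γ` (= `βm` ON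
`]0,γ]^{k+1}`, = `β⁰_{k+1}` OFF it) satisfies NE4 `ScaleShiftRate c ρ γ'` IFF
(a) `ScaleShiftRate c ρ γ βm` (histories on the record box), AND
(b) `∀ k, ∀ v ∈ ]0,γ]^{k+1}, |β⁰_{k+2} − βm_{k+1}(v)| ≤ cρ^k` (first coupling off the record box, tail on it: the merged β at every history of the record
box is uniformly `cρ^k`-close to the NEXT one-loop number), AND
(c) `∀ k, |β⁰_{k+2} − β⁰_{k+1}| ≤ cρ^k` (tail off the record box: the one-loop numbers are geometrically Cauchy).
Clause (b) makes Bałaban's full β asymptotically HISTORY-FREE on the record box: never a free reading of the node. [cite: Balaban1987RG1, (1.22) p.264 («defined on the interval [0, γ]») and (2.12)-(2.14) p.268] -/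
theorem scaleShiftRate_betaOfMerged_iff_of_lt (hγ' : 0 < γ') (hlt : γ < γ') :
    ScaleShiftRate c ρ γ' (betaOfMerged βm β0 γ) ↔
      ScaleShiftRate c ρ γ βm ∧
        (∀ k (v : Fin (k + 1) → ℝ), v ∈ Box γ k → |β0 (k + 1) - βm k v| ≤ c * ρ ^ k) ∧
        (∀ k, |β0 (k + 1) - β0 k| ≤ c * ρ ^ k) := by
  constructor
  · intro h
    refine ⟨fun k w hw => ?_, fun k v hv => ?_, fun k => ?_⟩
    · have hk := h k w (box_mono hlt.le _ hw)
      rwa [betaOfMerged_of_mem _ _ _ hw, betaOfMerged_of_mem _ _ _ (tail_mem_box hw)] at hk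
    · obtain ⟨hw, hnot⟩ := cons_mem_box_and_notMem hlt hv
      have hk := h k _ hw
      rwa [betaOfMerged_of_notMem _ _ _ hnot, Fin.tail_cons, betaOfMerged_of_mem _ _ _ hv] at hk
    · obtain ⟨hw, hnot, htail⟩ := const_mem_box_and_tail_notMem hγ' hlt k
      have hk := h k _ hw
      rwa [betaOfMerged_of_notMem _ _ _ hnot, betaOfMerged_of_notMem _ _ _ htail] at hk
  · rintro ⟨ha, hb, hc⟩ k w hw
    by_cases hm : w ∈ Box γ (k + 1)
    · rw [betaOfMerged_of_mem _ _ _ hm, betaOfMerged_of_mem _ _ _ (tail_mem_box hm)]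
      exact ha k w hm
    · rw [betaOfMerged_of_notMem _ _ _ hm]
      by_cases ht : Fin.tail w ∈ Box γ k
      · rw [betaOfMerged_of_mem _ _ _ ht]
        exact hb k _ ht
      · rw [betaOfMerged_of_notMem _ _ _ ht]
        exact hc k

/-- **NE4 BEYOND THE RECORD BOX ⟹ THE MERGED β IS NEAR THE NEXT ONE-LOOP NUMBER, UNIFORMLY ON THE RECORD BOX** (clause (b) of the `iff`).
[cite: Balaban1987RG1, (2.12)-(2.14) p.268] -/
theorem merged_near_beta0_of_scaleShiftRate_of_lt (hγ' : 0 < γ') (hlt : γ < γ')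
    (h : ScaleShiftRate c ρ γ' (betaOfMerged βm β0 γ)) {k : ℕ} {v : Fin (k + 1) → ℝ} (hv : v ∈ Box γ k) :
    |β0 (k + 1) - βm k v| ≤ c * ρ ^ k :=
  ((scaleShiftRate_betaOfMerged_iff_of_lt hγ' hlt).mp h).2.1 k v hv

/-- **… HENCE ASYMPTOTICALLY HISTORY-FREE ON THE RECORD BOX**: `|βm_{k+1}(v) − βm_{k+1}(v')| ≤ 2cρ^k` for all histories `v, v'` of the record box — the
content NE4 on a box `γ' > γ` would impose on Bałaban's (1.22) (whose history dependence is the remainder (2.13)); never a free witness.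
[cite: Balaban1987RG1, (2.12)-(2.14) p.268] -/
theorem merged_oscillation_le_of_scaleShiftRate_of_lt (hγ' : 0 < γ') (hlt : γ < γ')
    (h : ScaleShiftRate c ρ γ' (betaOfMerged βm β0 γ)) {k : ℕ} {v v' : Fin (k + 1) → ℝ} (hv : v ∈ Box γ k) (hv' : v' ∈ Box γ k) :
    |βm k v - βm k v'| ≤ 2 * c * ρ ^ k := by
  have h1 := merged_near_beta0_of_scaleShiftRate_of_lt hγ' hlt h hv
  have h2 := merged_near_beta0_of_scaleShiftRate_of_lt hγ' hlt h hv'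
  have e : βm k v - βm k v' = (β0 (k + 1) - βm k v') - (β0 (k + 1) - βm k v) := by ring
  rw [e]
  calc |(β0 (k + 1) - βm k v') - (β0 (k + 1) - βm k v)| ≤ |β0 (k + 1) - βm k v'| + |β0 (k + 1) - βm k v| := abs_sub _ _
    _ ≤ c * ρ ^ k + c * ρ ^ k := add_le_add h2 h1
    _ = 2 * c * ρ ^ k := by ring

/-- **NE4 BEYOND THE RECORD BOX ⟹ (AF-0r) IN CAUCHY FORM FOR THE ONE-LOOP NUMBERS, with no limit clause** (clause (c) of the `iff`; contrast companion 4
§15, where on the record box the definer's `Beta0LimitExists` was needed). [cite: Balaban1987RG1, (2.12)-(2.14) p.268] -/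
theorem beta0_cauchy_of_scaleShiftRate_of_lt (hγ' : 0 < γ') (hlt : γ < γ')
    (h : ScaleShiftRate c ρ γ' (betaOfMerged βm β0 γ)) (k : ℕ) : |β0 (k + 1) - β0 k| ≤ c * ρ ^ k :=
  ((scaleShiftRate_betaOfMerged_iff_of_lt hγ' hlt).mp h).2.2 k

end CapIff

/-! ## §21 N17 AT THE STAGE-8 DATUM `datumOfRecord₅ F N (θ.toStage5 F N)` — companion 4 instantiated with `hD := Node00.βfun_stage8 F N θ` -/

section Datum
variable {F : T4Family} {N : ℕ} [NeZero N]

/-- **N17 AT D₀ IS N17 OF THE MERGED β OF RECORD** on every box side `γ' ≤ θ.γ`: `NE4OnData (datumOfRecord₅ F N (θ.toStage5 F N)) c ρ γ' ↔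
ScaleShiftRate c ρ γ' βm₈` with `βm₈ = betaMerged F (mergedTermFamilyMat F N (chi7 F N θ) θ.εbg) θ.ρ8 θ.bV` (companion 4 `N17_atRecord_iff_merged` at
`Node00.βfun_stage8`). [cite: Balaban1987RG1, (1.20)-(1.22) p.264] -/
theorem N17_datumOfRecord₈_iff_merged (θ : Stage8Params F N) {c ρ γ' : ℝ} (hγ : γ' ≤ θ.γ) :
    NE4OnData (datumOfRecord₅ F N (θ.toStage5 F N)) c ρ γ' ↔
      letI := θ.instVβ₁; letI := θ.instVβ₂; letI := θ.instιβ
      ScaleShiftRate c ρ γ' (betaMerged F (mergedTermFamilyMat F N (chi7 F N θ) θ.εbg) θ.ρ8 θ.bV) :=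
  N17_atRecord_iff_merged _ (βfun_stage8 F N θ) hγ

/-- **NODE U2's INPUT TRIPLE AT D₀ reads the merged β of record** (box side `γ' ≤ θ.γ`): `U2Inputs D₀ c C ρ γ' Λ ↔ ScaleShiftRate c ρ γ' βm₈ ∧
HistLipschitz Λ γ' βm₈ ∧ FadingMemory C ρ Λ`. [cite: Balaban1987RG1, §5 p.298] -/
theorem u2Inputs_datumOfRecord₈_iff (θ : Stage8Params F N) {c C ρ γ' : ℝ} {Λ : ℕ → ℕ → ℝ} (hγ : γ' ≤ θ.γ) :
    U2Inputs (datumOfRecord₅ F N (θ.toStage5 F N)) c C ρ γ' Λ ↔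
      letI := θ.instVβ₁; letI := θ.instVβ₂; letI := θ.instιβ
      ScaleShiftRate c ρ γ' (betaMerged F (mergedTermFamilyMat F N (chi7 F N θ) θ.εbg) θ.ρ8 θ.bV) ∧
        HistLipschitz Λ γ' (betaMerged F (mergedTermFamilyMat F N (chi7 F N θ) θ.εbg) θ.ρ8 θ.bV) ∧ FadingMemory C ρ Λ :=
  u2Inputs_atRecord_iff _ (βfun_stage8 F N θ) hγ

/-- **THE SPLIT ROAD AT D₀** («β⁰ conv + β¹ shift», companion 1 §2 ∕ companion 4 §14): (AF-0r) `|β⁰_{k+1} − β⁰_∞| ≤ c₀ρ^k` for the record's NAMED one-loop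
number `β⁰ := beta0OfMerged βm₈ θ.v₀` ∧ `ScaleShiftRate c₁ ρ γ' (βm₈ − β⁰)` for the merged remainder, `γ' ≤ θ.γ`, `0 ≤ ρ ≤ 1`, `0 ≤ c₀` ⟹
`NE4OnData D₀ (2c₀ + c₁) ρ γ'`.  Both binders UNPRINTED. [cite: Balaban1987RG1, (2.12)-(2.14) p.268] -/
theorem N17_datumOfRecord₈_of_rates (θ : Stage8Params F N) {binf c₀ c₁ ρ γ' : ℝ} (hγ : γ' ≤ θ.γ) (hρ0 : 0 ≤ ρ) (hρ1 : ρ ≤ 1)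
    (hc₀ : 0 ≤ c₀)
    (hconv : letI := θ.instVβ₁; letI := θ.instVβ₂; letI := θ.instιβ
      ∀ k, |beta0OfMerged (betaMerged F (mergedTermFamilyMat F N (chi7 F N θ) θ.εbg) θ.ρ8 θ.bV) θ.v₀ k - binf| ≤ c₀ * ρ ^ k)
    (hrem : letI := θ.instVβ₁; letI := θ.instVβ₂; letI := θ.instιβ
      ScaleShiftRate c₁ ρ γ' fun k w =>
        betaMerged F (mergedTermFamilyMat F N (chi7 F N θ) θ.εbg) θ.ρ8 θ.bV k w -
          beta0OfMerged (betaMerged F (mergedTermFamilyMat F N (chi7 F N θ) θ.εbg) θ.ρ8 θ.bV) θ.v₀ k) :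
    NE4OnData (datumOfRecord₅ F N (θ.toStage5 F N)) (2 * c₀ + c₁) ρ γ' :=
  N17_atRecord_of_rates _ (βfun_stage8 F N θ) hγ hρ0 hρ1 hc₀ hconv hrem

/-- **WHAT N17 DELIVERS AT D₀.**  On a box side `0 < γ' ≤ θ.γ` with `0 ≤ ρ < 1`: if the definer's one-sided limit `Beta0LimitExists βm₈ θ.v₀` holds at
reference histories that are COHERENT (`Fin.tail (θ.v₀ (k+1)) = θ.v₀ k`) and ADMISSIBLE (entries in `]0,γ']`), then `NE4OnData D₀ c ρ γ'` ALONE yields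
(AF-0r) `∃ β⁰_∞, |β⁰_{k+1} − β⁰_∞| ≤ (c∕(1−ρ))ρ^k` for the record's one-loop number `beta0OfMerged βm₈ θ.v₀` AND the merged remainder's rate (constant
`c + 2c∕(1−ρ)`) — at the record the node's β⁰-half is an OUTPUT feeding the `hconv` consumers of NODE O ∕ K3 (companion 4
`atRecord_content_of_scaleShiftRate_merged` at `βfun_stage8`). [cite: Balaban1987RG1, (2.12)-(2.14) p.268] -/
theorem content_of_N17_datumOfRecord₈ (θ : Stage8Params F N) {c ρ γ' : ℝ} (hγ : γ' ≤ θ.γ) (hγ' : 0 < γ') (hρ0 : 0 ≤ ρ)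
    (hρ1 : ρ < 1)
    (hlim : letI := θ.instVβ₁; letI := θ.instVβ₂; letI := θ.instιβ
      Beta0LimitExists (betaMerged F (mergedTermFamilyMat F N (chi7 F N θ) θ.εbg) θ.ρ8 θ.bV) θ.v₀)
    (hcoh : ∀ k, Fin.tail (θ.v₀ (k + 1)) = θ.v₀ k) (hadm : ∀ k i, 0 < θ.v₀ k i ∧ θ.v₀ k i ≤ γ')
    (h : NE4OnData (datumOfRecord₅ F N (θ.toStage5 F N)) c ρ γ') :
    letI := θ.instVβ₁; letI := θ.instVβ₂; letI := θ.instιβ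
    (∃ binf : ℝ, ∀ k,
        |beta0OfMerged (betaMerged F (mergedTermFamilyMat F N (chi7 F N θ) θ.εbg) θ.ρ8 θ.bV) θ.v₀ k - binf| ≤ c / (1 - ρ) * ρ ^ k) ∧
      ScaleShiftRate (c + 2 * (c / (1 - ρ))) ρ γ' (fun k w =>
        betaMerged F (mergedTermFamilyMat F N (chi7 F N θ) θ.εbg) θ.ρ8 θ.bV k w -
          beta0OfMerged (betaMerged F (mergedTermFamilyMat F N (chi7 F N θ) θ.εbg) θ.ρ8 θ.bV) θ.v₀ k) := by
  letI := θ.instVβ₁; letI := θ.instVβ₂; letI := θ.instιβ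
  have hm := (N17_datumOfRecord₈_iff_merged θ hγ).mp h
  exact (atRecord_content_of_scaleShiftRate_merged hγ hγ' hρ0 hρ1 hlim hcoh hadm hm).2

/-- **N17 AT D₀ END TO END IN KERNEL CURRENCY** (companion 4 `N17_atAssemblyLine_of_kernelStepRate` at `βfun_stage8`): (UD) — the (5.10)-decay of the
record's OWN limiting polarisation kernels `polLimit F (k+1) (mergedTermFamilyMat F N (chi7 F N θ) θ.εbg k v ·) θ.ρ8 θ.bV` in the `(0,1)` component on the
boxes `]0,γ']` — ∧ the HISTORY-MATCHED KERNEL STEP RATE `|Π_{k+2}(w; x) − Π_{k+1}(tail w; x)| ≤ C′ρ^k e^{−δ′|x|₁}` there, `0 < γ' ≤ θ.γ`, `0 ≤ ρ < 1`, and the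
definer's `Beta0LimitExists` at coherent admissible `θ.v₀` ⟹ `NE4OnData D₀ (β′(C′,δ′)) ρ γ'` ∧ (AF-0r) for `beta0OfMerged βm₈ θ.v₀` (constant
`β′(C′,δ′)∕(1−ρ)`).  (UD) is PRINTED for Bałaban's kernels ((5.10) p. 293) but a hypothesis here; the step rate is NOT PRINTED (King's (4.38) is the A = 0
template) — rows NE2∕NE3∕NE5 (N15∕N16∕N18) in the record's letters. [cite: Balaban1987RG1, (1.21)-(1.22) p.264 and (5.10) p.293] -/
theorem N17_datumOfRecord₈_of_kernelStepRate (θ : Stage8Params F N) {C δ C' δ' ρ γ' : ℝ} (hγ : γ' ≤ θ.γ) (hγ' : 0 < γ')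
    (hρ0 : 0 ≤ ρ) (hρ1 : ρ < 1) (hδ : 0 < δ) (hδ' : 0 < δ')
    (hU : letI := θ.instVβ₁; letI := θ.instVβ₂; letI := θ.instιβ
      ∀ k (v : Fin (k + 1) → ℝ), v ∈ Box γ' k →
        Decay510 (polLimit F (k + 1) (fun K => mergedTermFamilyMat F N (chi7 F N θ) θ.εbg k v K) θ.ρ8 θ.bV 0 1) C δ)
    (hS : letI := θ.instVβ₁; letI := θ.instVβ₂; letI := θ.instιβ
      ∀ k (w : Fin (k + 2) → ℝ), w ∈ Box γ' (k + 1) →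
        Decay510 (subKernel (polLimit F (k + 1 + 1) (fun K => mergedTermFamilyMat F N (chi7 F N θ) θ.εbg (k + 1) w K) θ.ρ8 θ.bV)
          (polLimit F (k + 1) (fun K => mergedTermFamilyMat F N (chi7 F N θ) θ.εbg k (Fin.tail w) K) θ.ρ8 θ.bV) 0 1) (C' * ρ ^ k) δ')
    (hlim : letI := θ.instVβ₁; letI := θ.instVβ₂; letI := θ.instιβ
      Beta0LimitExists (betaMerged F (mergedTermFamilyMat F N (chi7 F N θ) θ.εbg) θ.ρ8 θ.bV) θ.v₀)
    (hcoh : ∀ k, Fin.tail (θ.v₀ (k + 1)) = θ.v₀ k) (hadm : ∀ k i, 0 < θ.v₀ k i ∧ θ.v₀ k i ≤ γ') :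
    NE4OnData (datumOfRecord₅ F N (θ.toStage5 F N)) (betaPrime510 4 C' δ') ρ γ' ∧
      letI := θ.instVβ₁; letI := θ.instVβ₂; letI := θ.instιβ
      ∃ binf : ℝ, ∀ k,
        |beta0OfMerged (betaMerged F (mergedTermFamilyMat F N (chi7 F N θ) θ.εbg) θ.ρ8 θ.bV) θ.v₀ k - binf| ≤
          betaPrime510 4 C' δ' / (1 - ρ) * ρ ^ k := by
  letI := θ.instVβ₁; letI := θ.instVβ₂; letI := θ.instιβ
  exact N17_atAssemblyLine_of_kernelStepRate _ _ θ.ρ8 θ.bV (βfun_stage8 F N θ) hγ hγ' hρ0 hρ1 hδ hδ' hU hS hlim hcoh hadm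

/-- **THE CAP AT STAGE 8, as an `iff`** (§20 at `βfun_stage8`): at admissible Stage-8 parameters, on a box LARGER than the record box (`θ.γ < γ'`) the
datum satisfies `NE4OnData D₀ c ρ γ'` IFF the merged β of record satisfies NE4 on the record box ∧ is uniformly `cρ^k`-close on the record box to the
next one-loop number `beta0OfMerged βm₈ θ.v₀ (k+1)` ∧ the one-loop numbers of record are geometrically Cauchy.  So N17's box at D₀ exceeds `θ.γ` only
under that constraint on Bałaban's β — the crux text takes `γ' ≤ θ.γ`. [cite: Balaban1987RG1, (1.22) p.264 («defined on the interval [0, γ]»)] -/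
theorem N17_datumOfRecord₈_iff_of_lt (θ : Stage8Params F N) (hθ : θ.Admissible) {c ρ γ' : ℝ} (hlt : θ.γ < γ') :
    NE4OnData (datumOfRecord₅ F N (θ.toStage5 F N)) c ρ γ' ↔
      letI := θ.instVβ₁; letI := θ.instVβ₂; letI := θ.instιβ
      ScaleShiftRate c ρ θ.γ (betaMerged F (mergedTermFamilyMat F N (chi7 F N θ) θ.εbg) θ.ρ8 θ.bV) ∧
        (∀ k (v : Fin (k + 1) → ℝ), v ∈ Box θ.γ k →
          |beta0OfMerged (betaMerged F (mergedTermFamilyMat F N (chi7 F N θ) θ.εbg) θ.ρ8 θ.bV) θ.v₀ (k + 1) -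
              betaMerged F (mergedTermFamilyMat F N (chi7 F N θ) θ.εbg) θ.ρ8 θ.bV k v| ≤ c * ρ ^ k) ∧
        (∀ k, |beta0OfMerged (betaMerged F (mergedTermFamilyMat F N (chi7 F N θ) θ.εbg) θ.ρ8 θ.bV) θ.v₀ (k + 1) -
            beta0OfMerged (betaMerged F (mergedTermFamilyMat F N (chi7 F N θ) θ.εbg) θ.ρ8 θ.bV) θ.v₀ k| ≤ c * ρ ^ k) := by
  letI := θ.instVβ₁; letI := θ.instVβ₂; letI := θ.instιβ
  have h0 : 0 < θ.γ := hθ.1.1.2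
  rw [ne4OnData_iff, βfun_stage8]
  exact scaleShiftRate_betaOfMerged_iff_of_lt (h0.trans hlt) hlt

/-- **THE CAP AT STAGE 8, pointwise**: at admissible `θ`, if `NE4OnData D₀ c ρ γ'` held on a box `γ' > θ.γ`, the merged β of record would be uniformly
`cρ^k`-close on the record box to its next one-loop number — asymptotically history-free. [cite: Balaban1987RG1, (2.12)-(2.14) p.268] -/
theorem merged₈_near_beta0_of_N17_of_lt (θ : Stage8Params F N) (hθ : θ.Admissible) {c ρ γ' : ℝ} (hlt : θ.γ < γ')
    (h : NE4OnData (datumOfRecord₅ F N (θ.toStage5 F N)) c ρ γ') {k : ℕ} {v : Fin (k + 1) → ℝ} (hv : v ∈ Box θ.γ k) :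
    letI := θ.instVβ₁; letI := θ.instVβ₂; letI := θ.instιβ
    |beta0OfMerged (betaMerged F (mergedTermFamilyMat F N (chi7 F N θ) θ.εbg) θ.ρ8 θ.bV) θ.v₀ (k + 1) -
        betaMerged F (mergedTermFamilyMat F N (chi7 F N θ) θ.εbg) θ.ρ8 θ.bV k v| ≤ c * ρ ^ k :=
  ((N17_datumOfRecord₈_iff_of_lt θ hθ hlt).mp h).2.1 k v hv

end Datum

/-! ## §22 N17 AT THE RECORD PREDICATE `IsRecordOfRecord₈C F N D w` — `∀`-form over the admissible witnesses; box = the world's window `]0, w.γ]` -/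

section RecordPredicate
variable {F : T4Family} {N : ℕ} [NeZero N]

/-- **N17 AT A STAGE-8 RECORD `(D, w)`.**  If at EVERY admissible Stage-8 parameter whose datum is `D` and whose record box contains the world's window
the merged β of record satisfies `ScaleShiftRate c ρ w.γ`, then `NE4OnData D c ρ w.γ` — the box side `w.γ ≤ θ.γ` and its positivity being CLAUSES of the
record predicate (b2b dagwriter (B′)).  Hypothesis displayed, not asserted (rows NE2∕NE3∕NE5 through (1.22)); count-neutral.
[cite: Balaban1987RG1, (1.20)-(1.22) p.264; Balaban1989LargeFieldII, Thm 1 p.355] -/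
theorem N17_of_isRecordOfRecord₈C {D : FiniteEpsData F (SU N)} {w : WorldP} (h : IsRecordOfRecord₈C F N D w) {c ρ : ℝ}
    (hin : ∀ θ : Stage8Params F N, θ.Admissible → D = datumOfRecord₅ F N (θ.toStage5 F N) → w.γ ≤ θ.γ →
      letI := θ.instVβ₁; letI := θ.instVβ₂; letI := θ.instιβ
      ScaleShiftRate c ρ w.γ (betaMerged F (mergedTermFamilyMat F N (chi7 F N θ) θ.εbg) θ.ρ8 θ.bV)) :
    NE4OnData D c ρ w.γ := by
  obtain ⟨θ, hθ, hD, -, ⟨-, hγle⟩, -, -⟩ := h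
  have hm := hin θ hθ hD hγle
  subst hD
  exact (N17_datumOfRecord₈_iff_merged θ hγle).mpr hm

/-- **N17 AT A STAGE-8 RECORD BY THE SPLIT ROAD**: (AF-0r) for `beta0OfMerged βm₈ θ.v₀` (constant `c₀ ≥ 0`) ∧ the merged remainder's rate (constant `c₁`)
on the world's window, asked of every admissible witness, `0 ≤ ρ ≤ 1` ⟹ `NE4OnData D (2c₀ + c₁) ρ w.γ`. [cite: Balaban1987RG1, (2.12)-(2.14) p.268] -/
theorem N17_of_isRecordOfRecord₈C_rates {D : FiniteEpsData F (SU N)} {w : WorldP} (h : IsRecordOfRecord₈C F N D w) {c₀ c₁ ρ : ℝ}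
    (hρ0 : 0 ≤ ρ) (hρ1 : ρ ≤ 1) (hc₀ : 0 ≤ c₀)
    (hin : ∀ θ : Stage8Params F N, θ.Admissible → D = datumOfRecord₅ F N (θ.toStage5 F N) → w.γ ≤ θ.γ →
      letI := θ.instVβ₁; letI := θ.instVβ₂; letI := θ.instιβ
      ∃ binf : ℝ,
        (∀ k, |beta0OfMerged (betaMerged F (mergedTermFamilyMat F N (chi7 F N θ) θ.εbg) θ.ρ8 θ.bV) θ.v₀ k - binf| ≤ c₀ * ρ ^ k) ∧
        ScaleShiftRate c₁ ρ w.γ fun k v =>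
          betaMerged F (mergedTermFamilyMat F N (chi7 F N θ) θ.εbg) θ.ρ8 θ.bV k v -
            beta0OfMerged (betaMerged F (mergedTermFamilyMat F N (chi7 F N θ) θ.εbg) θ.ρ8 θ.bV) θ.v₀ k) :
    NE4OnData D (2 * c₀ + c₁) ρ w.γ := by
  obtain ⟨θ, hθ, hD, -, ⟨-, hγle⟩, -, -⟩ := h
  obtain ⟨binf, hconv, hrem⟩ := hin θ hθ hD hγle
  subst hD
  exact N17_datumOfRecord₈_of_rates θ hγle hρ0 hρ1 hc₀ hconv hrem

/-- **N17 AT A STAGE-8 RECORD IN KERNEL CURRENCY**: (UD) ((5.10)-decay, some `C` and `δ > 0` per witness) ∧ the history-matched step rate (FIXED `C′`,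
`δ′ > 0`, any rate letter `ρ`) of the record's own limiting polarisation kernels on the world's window, asked of every admissible witness ⟹
`NE4OnData D (β′(C′,δ′)) ρ w.γ` (§21's end-to-end theorem through the predicate; the (AF-0r) half needs the witness's `θ.v₀` and is §21's pointed form).
[cite: Balaban1987RG1, (1.21)-(1.22) p.264 and (5.10) p.293] -/
theorem N17_of_isRecordOfRecord₈C_kernelStepRate {D : FiniteEpsData F (SU N)} {w : WorldP} (h : IsRecordOfRecord₈C F N D w)
    {C' δ' ρ : ℝ} (hδ' : 0 < δ')
    (hin : ∀ θ : Stage8Params F N, θ.Admissible → D = datumOfRecord₅ F N (θ.toStage5 F N) → w.γ ≤ θ.γ →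
      letI := θ.instVβ₁; letI := θ.instVβ₂; letI := θ.instιβ
      (∃ C δ : ℝ, 0 < δ ∧ ∀ k (v : Fin (k + 1) → ℝ), v ∈ Box w.γ k →
        Decay510 (polLimit F (k + 1) (fun K => mergedTermFamilyMat F N (chi7 F N θ) θ.εbg k v K) θ.ρ8 θ.bV 0 1) C δ) ∧
      (∀ k (u : Fin (k + 2) → ℝ), u ∈ Box w.γ (k + 1) →
        Decay510 (subKernel (polLimit F (k + 1 + 1) (fun K => mergedTermFamilyMat F N (chi7 F N θ) θ.εbg (k + 1) u K) θ.ρ8 θ.bV)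
          (polLimit F (k + 1) (fun K => mergedTermFamilyMat F N (chi7 F N θ) θ.εbg k (Fin.tail u) K) θ.ρ8 θ.bV) 0 1) (C' * ρ ^ k) δ')) :
    NE4OnData D (betaPrime510 4 C' δ') ρ w.γ := by
  obtain ⟨θ, hθ, hD, -, ⟨-, hγle⟩, -, -⟩ := h
  obtain ⟨⟨C, δ, hδ, hU⟩, hS⟩ := hin θ hθ hD hγle
  subst hD
  letI := θ.instVβ₁; letI := θ.instVβ₂; letI := θ.instιβ
  have hm := scaleShiftRate_betaMerged_of_kernelStepRate F (mergedTermFamilyMat F N (chi7 F N θ) θ.εbg) θ.ρ8 θ.bV hδ hδ' hU hS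
  exact (N17_datumOfRecord₈_iff_merged θ hγle).mpr hm

/-- **NODE U2's INPUT TRIPLE AT A STAGE-8 RECORD** (the N17 → N27 edge's input; the edge is companion 3's `u2Output_under_of_N17_gap` at `D` verbatim): N17 ∧
node U2's history moduli OF THE MERGED β on the world's window ∧ the β-free fading-memory clause, asked of every admissible witness ⟹
`U2Inputs D c C ρ w.γ Λ`. [cite: Balaban1987RG1, §5 p.298] -/
theorem u2Inputs_of_isRecordOfRecord₈C {D : FiniteEpsData F (SU N)} {w : WorldP} (h : IsRecordOfRecord₈C F N D w) {c C ρ : ℝ}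
    {Λ : ℕ → ℕ → ℝ} (hF : FadingMemory C ρ Λ)
    (hin : ∀ θ : Stage8Params F N, θ.Admissible → D = datumOfRecord₅ F N (θ.toStage5 F N) → w.γ ≤ θ.γ →
      letI := θ.instVβ₁; letI := θ.instVβ₂; letI := θ.instιβ
      ScaleShiftRate c ρ w.γ (betaMerged F (mergedTermFamilyMat F N (chi7 F N θ) θ.εbg) θ.ρ8 θ.bV) ∧
        HistLipschitz Λ w.γ (betaMerged F (mergedTermFamilyMat F N (chi7 F N θ) θ.εbg) θ.ρ8 θ.bV)) :
    U2Inputs D c C ρ w.γ Λ := by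
  obtain ⟨θ, hθ, hD, -, ⟨-, hγle⟩, -, -⟩ := h
  obtain ⟨hm, hL⟩ := hin θ hθ hD hγle
  subst hD
  exact (u2Inputs_datumOfRecord₈_iff θ hγle).mpr ⟨hm, hL, hF⟩

end RecordPredicate

/-! ## §23 THE ZERO-CHART INHABITANT OF `IsRecordOfRecord₈C` AND N17 (chair R445 (A) species for the N17 row): at `θ.ρ8 = 0` the node and its kernel
inputs hold BY JUNK — the countable Stage-8 form of N17 is §22's `∀`-form with the chart displayed -/

section ZeroChart
variable {F : T4Family} {N : ℕ} [NeZero N]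

/-- **AT A ZERO-CHART `θ` N17 HOLDS AT D₀ WITH EVERY CONSTANT**: `θ.ρ8 = 0` ⟹ the datum's `βfun` is `zeroHBeta`
(`Record8Inhabited.βfun_datumOfRecord₈_of_zeroChart`) ⟹ `NE4OnData D₀ c ρ γ'` for every `c ≥ 0`, `ρ ≥ 0`, every box (companion 1's `N17_of_betaZero` species) —
JUNK truth, said as such. [cite: Balaban1987RG1, (1.20)-(1.22) p.264 (bookkeeping at `ρ = 0`)] -/
theorem N17_datumOfRecord₈_of_zeroChart (θ : Stage8Params F N) (hρ8 : letI := θ.instVβ₁; letI := θ.instVβ₂; θ.ρ8 = 0)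
    {c ρ : ℝ} (γ' : ℝ) (hc : 0 ≤ c) (hρ : 0 ≤ ρ) : NE4OnData (datumOfRecord₅ F N (θ.toStage5 F N)) c ρ γ' := by
  rw [ne4OnData_iff, Record8Inhabited.βfun_datumOfRecord₈_of_zeroChart F N θ hρ8]
  intro k w _
  show |(0 : ℝ) - 0| ≤ c * ρ ^ k
  rw [sub_zero, abs_zero]
  exact mul_nonneg hc (pow_nonneg hρ k)

/-- **… AND SO DO §21's KERNEL INPUTS**: at a zero-chart `θ` the record's limiting polarisation kernels are the ZERO kernel
(`Record8Inhabited.polLimit_zeroChart`), so (UD) and the history-matched step rate hold with constants `C = 0`, `C′ = 0` for every `δ, δ′, ρ` and every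
box — the `∀`-form of §22 with kernel inputs is ALSO met by junk at the zero chart: its content lives at non-degenerate charts (NODE 00's Stage-9 pin).
[cite: Balaban1987RG1, (1.21) p.264 and (5.10) p.293 (bookkeeping at `ρ = 0`)] -/
theorem kernelStepRate_datumOfRecord₈_of_zeroChart (θ : Stage8Params F N)
    (hρ8 : letI := θ.instVβ₁; letI := θ.instVβ₂; θ.ρ8 = 0) (δ δ' ρ γ' : ℝ) :
    letI := θ.instVβ₁; letI := θ.instVβ₂; letI := θ.instιβ
    (∀ k (v : Fin (k + 1) → ℝ), v ∈ Box γ' k →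
        Decay510 (polLimit F (k + 1) (fun K => mergedTermFamilyMat F N (chi7 F N θ) θ.εbg k v K) θ.ρ8 θ.bV 0 1) 0 δ) ∧
      (∀ k (w : Fin (k + 2) → ℝ), w ∈ Box γ' (k + 1) →
        Decay510 (subKernel (polLimit F (k + 1 + 1) (fun K => mergedTermFamilyMat F N (chi7 F N θ) θ.εbg (k + 1) w K) θ.ρ8 θ.bV)
          (polLimit F (k + 1) (fun K => mergedTermFamilyMat F N (chi7 F N θ) θ.εbg k (Fin.tail w) K) θ.ρ8 θ.bV) 0 1) (0 * ρ ^ k) δ') := by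
  letI := θ.instVβ₁; letI := θ.instVβ₂; letI := θ.instιβ
  refine ⟨fun k v _ x => ?_, fun k w _ x => ?_⟩
  · rw [hρ8, Record8Inhabited.polLimit_zeroChart]
    simp
  · rw [subKernel_apply, hρ8, Record8Inhabited.polLimit_zeroChart, Record8Inhabited.polLimit_zeroChart]
    simp

/-- **A STAGE-8 RECORD AT WHICH N17 HOLDS WITH EVERY CONSTANT EXISTS** (every four-torus family, every `N ≥ 1`; any record box `γ > 0` and window
`0 < γw ≤ γ`): the zero-chart inhabitant of `Record8Inhabited` (DEGENERATE — not an object of record).  READING (R445 (A) for the N17 row): the `∃`-form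
«some Stage-8 record satisfies N17» is inhabited by junk; a countable N17-at-Stage-8 statement is the `∀`-form of §22 over the admissible witnesses WITH a
displayed non-degenerate chart, or any form after a chart clause of record. [cite: Balaban1987RG1, (1.20)-(1.22) p.264; Balaban1989LargeFieldII, Thm 1 p.355 (bookkeeping witness)] -/
theorem exists_isRecordOfRecord₈C_N17 {γ γw : ℝ} (h0 : 0 < γw) (hle : γw ≤ γ) :
    ∃ (D : FiniteEpsData F (SU N)) (w : WorldP), IsRecordOfRecord₈C F N D w ∧ w.γ = γw ∧ D.βfun = zeroHBeta ∧
      ∀ (c ρ γ' : ℝ), 0 ≤ c → 0 ≤ ρ → NE4OnData D c ρ γ' := by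
  obtain ⟨θ, hθ, -, hγ, hρ8⟩ := Record8Inhabited.exists_admissible_stage8Params_zeroChart F N γ (h0.trans_le hle)
  obtain ⟨w, hw, hwγ⟩ :=
    Record8Inhabited.exists_world_isRecordOfRecord₈C F N θ hθ (γw := γw) ⟨h0, by rw [hγ]; exact hle⟩
  exact ⟨_, w, hw, hwγ, Record8Inhabited.βfun_datumOfRecord₈_of_zeroChart F N θ hρ8,
    fun c ρ γ' hc hρ => N17_datumOfRecord₈_of_zeroChart θ hρ8 γ' hc hρ⟩

end ZeroChart

end Summit.QuantumFields.YangMills.Theorems.BalabanUVNodesN17
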